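import Literature.Barriers.RiemannHypothesis.BeurlingCounterexamples
import Literature.NumberTheory.BeurlingPrimes.MergePowers
import Literature.NumberTheory.BeurlingPrimes.RationalPrimes
import Literature.NumberTheory.BeurlingPrimes.PowerProductCount
import HarnessLib

/-!
# Broucke–Debruyne–Révész 2023, Theorem 1.3: the `[1/2, β]`-systems (`0 ≤ β < 1/2`) under RH — proofs

Sibling proofs file of `Literature/Barriers/RiemannHypothesis/BeurlingCounterexamples.lean` for the
named fact `Literature.Barriers.RiemannHypothesis.BrouckeDebruyneRevesz2023_thm13` ("Assume RH. Then
there exists a `[1/2, β]`-system for each `0 ≤ β < 1/2` and an `[α, β]`-system for `1/2 < α < 2/3`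
and `2α/(α + 2) ≤ β < 1/2`", arXiv:2309.01567, Theorem 1.3). The printed theorem is the conjunction
of two assertions of very different depth, which we record separately:

* `BrouckeDebruyneRevesz2023_thm13a` — the `[1/2, β]`-systems, `0 ≤ β < 1/2` — is **PROVED** here
  (`BrouckeDebruyneRevesz2023_thm13a_holds`), following §5 p. 14 of the source: for `β = 0` the
  system is `(ℙ, ℕ)` itself (`Literature.NumberTheory.BeurlingPrimes.ratPrimes_isSystem_of_riemannHypothesis`:
  von Koch's theorem under RH, and Hardy's theorem for "not for any `ε < 0`", both in-tree); for
  `0 < β < 1/2` it is `𝒫_β = ℙ ∪ ℙ^{1/β}` (`bdrSystem β⁻¹`), whose Chebyshev function is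
  `ψ(x) + β⁻¹ ψ(x^β) = x + O_ε(x^{1/2+ε})` and not `O(x^{1/2−ε})` (`chebyshevPsi_bdrSystem`), and whose
  integer-counting function `N_β(x) = ∑_{m ≤ x^β} ⌊x/m^{1/β}⌋` satisfies
  `−C x^β ≤ N_β(x) − ζ(1/β) x ≤ −c x^β` (`x ≥ 1`, `0 < c < C`;
  `Literature.NumberTheory.BeurlingPrimes.powProdCount_le`, `le_powProdCount`) — a two-sided bound
  replacing the printed second-order asymptotics `N_β(x) = ζ(1/β)x + ζ(β)x^β + O(x^{β/(β+1)})`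
  (Lemma 5.1, hyperbola method), which we do not need.
* `BrouckeDebruyneRevesz2023_thm13b` — the `[α, β]`-systems with `1/2 < α < 2/3`,
  `2α/(α+2) ≤ β < 1/2` — remains a NAMED FACT. Its printed proof (§5 pp. 15–17) deletes from `ℙ` a
  random set of primes `𝒫_S` with `π_S(x) = F(x) + O(1) ∼ Li(x^α)` chosen by the Broucke–Vindas
  random prime approximation (Theorem 1.2 of the source, [BrouckeVindas2024]) so that
  `log ζ_S(s) = log ζ(s + 1 − α) + O_ε(√log|t|)` on `Re s ≥ α/2 + ε`, obtains
  `N_S(x), N_S(x) + M_S(x) = a x^α + O_ε(x^{α/2+ε})` by Perron inversion (using the RH bounds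
  `ζ^{±1}(s) ≪_ε |t|^ε` on `Re s ≥ 1/2 + ε`), hence `M_S(x) ≪_ε x^{α/2+ε}`, and then counts the
  integers of `𝒫_{α,β} = ℙ ∪ ℙ^{1/β} ∖ 𝒫_S` by two applications of the hyperbola Lemma 5.1.
  None of the random construction, the Perron step for `ζ_S`, or Lemma 5.1 is in the tree yet.
* `BrouckeDebruyneRevesz2023_thm13_of_thm13b` — the assembly: the vendored Theorem 1.3 follows from
  part (b) alone, part (a) being proved; and conversely (`…_thm13b_of_thm13`).

## References
* [BrouckeDebruyneRevesz2023] F. Broucke, G. Debruyne, Sz. Gy. Révész, *Some examples of well-behaved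
  Beurling number systems*, arXiv:2309.01567, Trans. Amer. Math. Soc. (2024) doi:10.1090/tran/9274
  (read, arXiv version: §1 Theorems 1.1–1.3 pp. 3–4, §5 pp. 14–18, Lemma 5.1, Remarks 5.2–5.3).
* [BrouckeVindas2024] F. Broucke, J. Vindas, *A new generalized prime random approximation procedure
  and some of its applications*, Math. Z. 307 (2024), arXiv:2102.08478, Theorem 1.2 as quoted in
  [BrouckeDebruyneRevesz2023, Theorem 1.2].
* [Hilberdink2005] T. W. Hilberdink, *Well-behaved Beurling primes and integers*, J. Number Theory 112
  (2005) 332–344, §2.1 (`[α, β]`-systems).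
-/

noncomputable section

open Filter Set
open scoped Topology Chebyshev

namespace Literature.Barriers.RiemannHypothesis

open Literature.NumberTheory.BeurlingPrimes Literature.NumberTheory.LFunctions

/-! ### The system `𝒫_β = ℙ ∪ ℙ^{1/β}` (indexed by `s = 1/β`) -/

/-- **BDR's system `𝒫_β = ℙ ∪ ℙ^{1/β} = {p, p^{1/β} ∣ p prime}`**, written with `s = 1/β > 0`: the
merge of the rational primes with their `s`-th powers. [cite: BrouckeDebruyneRevesz2023, §5 p. 14] -/
def bdrSystem (s : ℝ) (hs : 0 < s) : BeurlingPrimes :=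
  ratPrimes.merge (ratPrimes.powers s hs)

variable {s : ℝ} (hs : 0 < s)

/-- **`ψ_{𝒫_β}(x) = ψ(x) + β⁻¹ ψ(x^β)`** (`x ≥ 0`; BDR: "`π_β(x) = π(x) + π(x^β)`").
[cite: BrouckeDebruyneRevesz2023, §5 p. 14] -/
theorem chebyshevPsi_bdrSystem {x : ℝ} (hx : 0 ≤ x) :
    (bdrSystem s hs).chebyshevPsi x = ψ x + s * ψ (x ^ s⁻¹) := by
  unfold bdrSystem
  rw [BeurlingPrimes.chebyshevPsi_merge, BeurlingPrimes.chebyshevPsi_powers _ hs hx,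
    chebyshevPsi_ratPrimes, chebyshevPsi_ratPrimes]

/-- Reshuffling a subtype of pairs of positive integers. [folklore] -/
def pairSubtypeEquiv (R : ℕ → ℕ → Prop) :
    {pq : {n : ℕ // n ≠ 0} × {m : ℕ // m ≠ 0} // R pq.1.1 pq.2.1} ≃
      {nm : ℕ × ℕ // nm.1 ≠ 0 ∧ nm.2 ≠ 0 ∧ R nm.1 nm.2} where
  toFun p := ⟨(p.1.1.1, p.1.2.1), p.1.1.2, p.1.2.2, p.2⟩
  invFun q := ⟨(⟨q.1.1, q.2.1⟩, ⟨q.1.2, q.2.2.1⟩), q.2.2.2⟩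
  left_inv _ := rfl
  right_inv _ := rfl

/-- **`N_{𝒫_β}(x) = ∑_{m ≤ x^β} ⌊x/m^{1/β}⌋ = D_s(x)`** (`x ≥ 0`): "The integers of this system are
formed by the products `n l^{1/β}` where `n, l` represent classical integers."
[cite: BrouckeDebruyneRevesz2023, §5 p. 14] -/
theorem intCount_bdrSystem {x : ℝ} (hx : 0 ≤ x) :
    (bdrSystem s hs).intCount x = powProdCount s x := by
  unfold bdrSystem
  rw [BeurlingPrimes.intCount_merge, ← card_eq_powProdCount hs hx]
  have e1 : {kk : (ℕ →₀ ℕ) × (ℕ →₀ ℕ) // ratPrimes.genInt kk.1 * (ratPrimes.powers s hs).genInt kk.2 ≤ x} ≃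
      {pq : {n : ℕ // n ≠ 0} × {m : ℕ // m ≠ 0} // ((pq.1.1 : ℕ) : ℝ) * ((pq.2.1 : ℕ) : ℝ) ^ s ≤ x} :=
    Equiv.subtypeEquiv (Equiv.prodCongr encodeEquiv encodeEquiv) fun kk ↦ by
      obtain ⟨k₁, k₂⟩ := kk
      rw [BeurlingPrimes.genInt_powers, genInt_ratPrimes, genInt_ratPrimes]
      rfl
  exact Nat.card_congr (e1.trans (pairSubtypeEquiv fun n m ↦ (n : ℝ) * (m : ℝ) ^ s ≤ x))

/-! ### The primes of `𝒫_β`: `1/2`-well-behaved under RH, and not better -/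

/-- Under RH, for `s > 2` (i.e. `β < 1/2`) and every `ε > 0`:
`|ψ_{𝒫_β}(x) − x| ≤ C x^{1/2+ε}` on `[1, ∞)` (von Koch for `ψ`, Chebyshev's bound
`ψ(x^β) ≪ x^β ≤ x^{1/2+ε}` for the adjoined primes). [cite: BrouckeDebruyneRevesz2023, §5 p. 14] -/
theorem bdrSystem_primeErrorLE (hRH : RiemannHypothesis) (hs2 : 2 < s) {ε : ℝ} (hε : 0 < ε) :
    (bdrSystem s hs).PrimeErrorLE (1 / 2 + ε) := by
  obtain ⟨C, hC⟩ := ratPrimes_primeErrorLE_of_riemannHypothesis hRH hε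
  refine ⟨C + s * (Real.log 4 + 4), fun x hx ↦ ?_⟩
  have hx0 : 0 ≤ x := by linarith
  have h1 := hC x hx
  rw [chebyshevPsi_ratPrimes] at h1
  rw [chebyshevPsi_bdrSystem hs hx0]
  have hxs0 : 0 ≤ x ^ s⁻¹ := Real.rpow_nonneg hx0 _
  have h2 : ψ (x ^ s⁻¹) ≤ (Real.log 4 + 4) * x ^ s⁻¹ := Chebyshev.psi_le_const_mul_self hxs0
  have h3 : x ^ s⁻¹ ≤ x ^ (1 / 2 + ε) := by
    refine Real.rpow_le_rpow_of_exponent_le hx ?_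
    have : s⁻¹ < 1 / 2 := by rw [inv_lt_comm₀ hs (by norm_num)]; norm_num; exact hs2
    linarith
  have h4 : 0 ≤ ψ (x ^ s⁻¹) := Chebyshev.psi_nonneg _
  have hl4 : 0 ≤ Real.log 4 + 4 := by positivity
  calc |ψ x + s * ψ (x ^ s⁻¹) - x| ≤ |ψ x - x| + s * ψ (x ^ s⁻¹) := by
        rw [abs_le]; constructor <;> nlinarith [abs_le.mp (le_refl |ψ x - x|), neg_abs_le (ψ x - x), le_abs_self (ψ x - x)]
    _ ≤ C * x ^ (1 / 2 + ε) + s * ((Real.log 4 + 4) * x ^ (1 / 2 + ε)) := by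
        gcongr
        exact h2.trans (mul_le_mul_of_nonneg_left h3 hl4)
    _ = (C + s * (Real.log 4 + 4)) * x ^ (1 / 2 + ε) := by ring

/-- … and not better: for `s > 2` and `γ < 1/2` there is no `C` with `|ψ_{𝒫_β}(x) − x| ≤ C x^γ` on
`[1, ∞)` — otherwise `|ψ(x) − x| ≪ x^{max(γ, 1/s)}` with `max(γ, 1/s) < 1/2`, contradicting Hardy's
theorem ("as can be seen from the presence of `ζ`-zeros on the line `Re s = 1/2`").
[cite: BrouckeDebruyneRevesz2023, §5 p. 14] -/
theorem not_bdrSystem_primeErrorLE (hs2 : 2 < s) {γ : ℝ} (hγ : γ < 1 / 2) :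
    ¬ (bdrSystem s hs).PrimeErrorLE γ := by
  rintro ⟨C, hC⟩
  have hsi : s⁻¹ < 1 / 2 := by rw [inv_lt_comm₀ hs (by norm_num)]; norm_num; exact hs2
  set γ' := max γ s⁻¹ with hγ'
  have hγ'lt : γ' < 1 / 2 := max_lt hγ hsi
  refine not_ratPrimes_primeErrorLE hγ'lt ⟨|C| + s * (Real.log 4 + 4), fun x hx ↦ ?_⟩
  have hx0 : 0 ≤ x := by linarith
  have h1 := hC x hx
  rw [chebyshevPsi_bdrSystem hs hx0] at h1
  rw [chebyshevPsi_ratPrimes]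
  have hxs0 : 0 ≤ x ^ s⁻¹ := Real.rpow_nonneg hx0 _
  have h2 : ψ (x ^ s⁻¹) ≤ (Real.log 4 + 4) * x ^ s⁻¹ := Chebyshev.psi_le_const_mul_self hxs0
  have h3 : x ^ s⁻¹ ≤ x ^ γ' := Real.rpow_le_rpow_of_exponent_le hx (le_max_right _ _)
  have h3' : x ^ γ ≤ x ^ γ' := Real.rpow_le_rpow_of_exponent_le hx (le_max_left _ _)
  have h4 : 0 ≤ ψ (x ^ s⁻¹) := Chebyshev.psi_nonneg _
  have hl4 : 0 ≤ Real.log 4 + 4 := by positivity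
  have hxγ : 0 ≤ x ^ γ := Real.rpow_nonneg hx0 _
  calc |ψ x - x| ≤ |ψ x + s * ψ (x ^ s⁻¹) - x| + s * ψ (x ^ s⁻¹) := by
        rw [abs_le]; constructor <;>
          nlinarith [neg_abs_le (ψ x + s * ψ (x ^ s⁻¹) - x), le_abs_self (ψ x + s * ψ (x ^ s⁻¹) - x)]
    _ ≤ |C| * x ^ γ' + s * ((Real.log 4 + 4) * x ^ γ') := by
        gcongr
        · calc |ψ x + s * ψ (x ^ s⁻¹) - x| ≤ C * x ^ γ := h1
            _ ≤ |C| * x ^ γ := mul_le_mul_of_nonneg_right (le_abs_self C) hxγ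
            _ ≤ |C| * x ^ γ' := mul_le_mul_of_nonneg_left h3' (abs_nonneg C)
        · exact h2.trans (mul_le_mul_of_nonneg_left h3 hl4)
    _ = (|C| + s * (Real.log 4 + 4)) * x ^ γ' := by ring

/-! ### The integers of `𝒫_β`: `β`-well-behaved, and not better -/

/-- For `s > 1` and `γ ≥ 1/s`: `|N_{𝒫_β}(x) − ζ(s) x| ≤ C x^γ` on `[1, ∞)` ("the generalized integers
are indeed `β`-well-behaved"). [cite: BrouckeDebruyneRevesz2023, §5 p. 14] -/
theorem bdrSystem_intErrorLE (hs1 : 1 < s) {γ : ℝ} (hγ : s⁻¹ ≤ γ) :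
    (bdrSystem s hs).IntErrorLE (zetaR s) γ := by
  refine ⟨2 ^ (s - 1) / (s - 1) + 1, fun x hx ↦ ?_⟩
  rw [intCount_bdrSystem hs (by linarith)]
  refine (abs_powProdCount_sub_le hs1 hx).trans ?_
  have hK : 0 ≤ 2 ^ (s - 1) / (s - 1) + 1 :=
    add_nonneg (div_nonneg (Real.rpow_nonneg (by norm_num) _) (by linarith)) zero_le_one
  exact mul_le_mul_of_nonneg_left (Real.rpow_le_rpow_of_exponent_le hx hγ) hK

/-- … "and not better": for `s > 1` and `γ < 1/s` there is no `C` with `|N_{𝒫_β}(x) − ζ(s) x| ≤ C x^γ`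
on `[1, ∞)`, since `ζ(s)x − N_{𝒫_β}(x) ≥ c x^{1/s}`. [cite: BrouckeDebruyneRevesz2023, §5 p. 14] -/
theorem not_bdrSystem_intErrorLE (hs1 : 1 < s) {γ : ℝ} (hγ : γ < s⁻¹) :
    ¬ (bdrSystem s hs).IntErrorLE (zetaR s) γ := by
  rintro ⟨C, hC⟩
  set c : ℝ := 2 ^ (1 - s) / (s - 1) with hc
  have hcpos : 0 < c := div_pos (Real.rpow_pos_of_pos (by norm_num) _) (by linarith)
  -- `c x^{1/s} ≤ C x^γ`, i.e. `c ≤ C x^{γ - 1/s} → 0`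
  have ht : Tendsto (fun x : ℝ ↦ C * x ^ (-(s⁻¹ - γ))) atTop (𝓝 0) := by
    have h := (tendsto_rpow_neg_atTop (y := s⁻¹ - γ) (by linarith)).const_mul C
    rwa [mul_zero] at h
  obtain ⟨X, hX⟩ := ((ht.eventually (gt_mem_nhds hcpos))).exists_forall_of_atTop
  set x : ℝ := max X 1 with hxdef
  have hx1 : 1 ≤ x := le_max_right _ _
  have hx0 : 0 < x := by linarith
  have h1 := hC x hx1
  rw [intCount_bdrSystem hs hx0.le] at h1
  have h2 := le_zetaR_mul_sub_powProdCount hs1 hx1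
  have h3 : c * x ^ s⁻¹ ≤ C * x ^ γ := by
    rw [abs_sub_comm] at h1
    exact le_trans h2 (le_trans (le_abs_self _) h1)
  have h4 : C * x ^ γ = C * x ^ (-(s⁻¹ - γ)) * x ^ s⁻¹ := by
    rw [mul_assoc, ← Real.rpow_add hx0]; congr 2; ring
  rw [h4] at h3
  have h5 : c ≤ C * x ^ (-(s⁻¹ - γ)) := le_of_mul_le_mul_right h3 (Real.rpow_pos_of_pos hx0 _)
  linarith [hX x (le_max_left _ _)]

/-- **`𝒫_β` is a `[1/2, β]`-system under RH** for `0 < β < 1/2` (with density `a = ζ(1/β)`).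
[cite: BrouckeDebruyneRevesz2023, Theorem 1.3 (§5 p. 14)] -/
theorem bdrSystem_isSystem (hRH : RiemannHypothesis) {β : ℝ} (hβ0 : 0 < β) (hβ : β < 1 / 2) :
    (bdrSystem β⁻¹ (inv_pos.mpr hβ0)).IsSystem (1 / 2) β := by
  have hs2 : 2 < β⁻¹ := by rw [lt_inv_comm₀ (by norm_num) hβ0]; norm_num; linarith
  have hs1 : 1 < β⁻¹ := by linarith
  refine ⟨by norm_num, by norm_num, hβ0.le, by linarith, zetaR β⁻¹, zetaR_pos hs1, ?_, ?_, ?_, ?_⟩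
  · intro ε hε
    exact bdrSystem_intErrorLE _ hs1 (by rw [inv_inv]; linarith)
  · intro ε hε
    exact not_bdrSystem_intErrorLE _ hs1 (by rw [inv_inv]; linarith)
  · intro ε hε
    exact bdrSystem_primeErrorLE _ hRH hs2 hε
  · intro ε hε
    exact not_bdrSystem_primeErrorLE _ hs2 (by linarith)

/-! ### Theorem 1.3 -/

/-- **Broucke–Debruyne–Révész 2023, Theorem 1.3, first assertion**: "Assume RH. Then there exists a
`[1/2, β]`-system for each `0 ≤ β < 1/2`." PROVED below (`BrouckeDebruyneRevesz2023_thm13a_holds`).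
[cite: BrouckeDebruyneRevesz2023, Theorem 1.3] -/
def BrouckeDebruyneRevesz2023_thm13a : Prop :=
  RiemannHypothesis → ∀ β : ℝ, 0 ≤ β → β < 1 / 2 → ∃ P : BeurlingPrimes, P.IsSystem (1 / 2) β

/-- **Broucke–Debruyne–Révész 2023, Theorem 1.3, second assertion** (NAMED FACT): "Assume RH. Then
there exists … an `[α, β]`-system for `1/2 < α < 2/3` and `2α/(α + 2) ≤ β < 1/2`." (§5 pp. 15–17:
`𝒫_{α,β} = ℙ ∪ ℙ^{1/β} ∖ 𝒫_S` with `𝒫_S ⊂ ℙ` a random subsequence, `π_S(x) ∼ Li(x^α)`, chosen by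
the Broucke–Vindas random approximation so that `M_S(x) ≪_ε x^{α/2+ε}`; integers counted by the
hyperbola Lemma 5.1.) Users take `(h : BrouckeDebruyneRevesz2023_thm13b)`.
[cite: BrouckeDebruyneRevesz2023, Theorem 1.3] -/
def BrouckeDebruyneRevesz2023_thm13b : Prop :=
  RiemannHypothesis → ∀ α β : ℝ, 1 / 2 < α → α < 2 / 3 → 2 * α / (α + 2) ≤ β → β < 1 / 2 →
    ∃ P : BeurlingPrimes, P.IsSystem α β

/-- **Proof of the first assertion of Theorem 1.3**: under RH, `(ℙ, ℕ)` is a `[1/2, 0]`-system and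
`ℙ ∪ ℙ^{1/β}` is a `[1/2, β]`-system for `0 < β < 1/2`. [cite: BrouckeDebruyneRevesz2023, Theorem 1.3 (§5 p. 14)] -/
theorem BrouckeDebruyneRevesz2023_thm13a_holds : BrouckeDebruyneRevesz2023_thm13a := by
  intro hRH β hβ0 hβ
  rcases hβ0.eq_or_lt with h | hβpos
  · rw [← h]
    exact ⟨ratPrimes, ratPrimes_isSystem_of_riemannHypothesis hRH⟩
  · exact ⟨_, bdrSystem_isSystem hRH hβpos hβ⟩

/-- **Assembly**: the vendored Theorem 1.3 follows from its second assertion (the first being proved).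
[cite: BrouckeDebruyneRevesz2023, Theorem 1.3] -/
theorem BrouckeDebruyneRevesz2023_thm13_of_thm13b (hb : BrouckeDebruyneRevesz2023_thm13b) :
    BrouckeDebruyneRevesz2023_thm13 :=
  fun hRH ↦ ⟨BrouckeDebruyneRevesz2023_thm13a_holds hRH, hb hRH⟩

/-- Conversely the second assertion is a clause of the vendored Theorem 1.3, so the two named facts
`BrouckeDebruyneRevesz2023_thm13` and `BrouckeDebruyneRevesz2023_thm13b` are equivalent.
[cite: BrouckeDebruyneRevesz2023, Theorem 1.3] -/
theorem BrouckeDebruyneRevesz2023_thm13b_of_thm13 (h : BrouckeDebruyneRevesz2023_thm13) :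
    BrouckeDebruyneRevesz2023_thm13b :=
  fun hRH ↦ (h hRH).2

end Literature.Barriers.RiemannHypothesis
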